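import Summits.HodgeConjecture.CorCM.GaloisCyclicSemidirectEightDegenerate
import Summits.HodgeConjecture.CorCM.GaloisCyclicSemidirectEightNormPredicate
import HarnessLib

/-!
# `C_p ⋊ C₈` is BAD whenever `ℤ/p` carries a `μ₄`-NORM PAIR — the complete singular-block format for `a = 1`

COR-CM (cell `pub-hodgecm2`), binder seat b04 (gen 28), count-neutral claim CYCLIC-SEMIDIRECT-EIGHT-DEGENERATE, part V.  KERNEL
ONLY: theorems; no definition, no named fact, no `sorry`.  `HC_CM` is neither used nor claimed.

EVERY CM set of `G₀ = C_p ⋊ C₈` (`φ(1)` = inversion, `c₀ = y⁴`) is a pair of `μ₄`-VALUED SHEETS `k₀, k₁ : ℤ/p → ℤ/4`: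
`⟨v, s⟩ ∈ T(k₀, k₁)` iff `s ∈ {2k₀(v), 2k₀(v)+2}` (`s` even) or `s ∈ {2k₁(v)+1, 2k₁(v)+3}` (`s` odd); its sheet sums at the odd
character `χ₀(t,v) = iᵗζᵛ` are `Ŝⱼ(χ₀) = (1+i)·Gⱼ(ζ)`, `Gⱼ(ζ) = Σ_v i^{kⱼ(v)} ζ^v`, and the two-sheet determinant is
`Δ(χ₀) = 2i·(G₀(ζ)G₀(ζ⁻¹) − i·G₁(ζ)G₁(ζ⁻¹))` — the NORM IDENTITY of gen 27's SAT searches.  Coefficient of `ζ^d`: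
`c₀(d) − i·c₁(d)` with `cⱼ(d) = Σ_v i^{kⱼ(v) + kⱼ(v−d)} = Σ_r Nⱼ(d,r) i^r`, `Nⱼ(d, r) = #{v : kⱼ(v) + kⱼ(v − d) = r}`; so the block is
singular as soon as the two integer functions `R(d) = N₀(d,0) − N₀(d,2) + N₁(d,1) − N₁(d,3)` and
`I(d) = N₀(d,1) − N₀(d,3) + N₁(d,2) − N₁(d,0)` are CONSTANT in `d` (a **`μ₄`-norm pair**; part III's difference pairs are the
two-valued case `k₀ ∈ {0,2}`, `k₁ ∈ {0,1}`).  PRIMITIVITY is automatic: `T(k₀,k₁)` has trivial left stabiliser iff `k₀, k₁` are not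
both constant (an even stabiliser `⟨v₀, 2σ⟩` forces `k(v₀+v) = k(v) + σ`, summing over `v` gives `pσ = 0`; an odd one is refuted on
the four points of two opposite fibres).  Hence **`exists_simple_degenerate_of_normPair`: a `μ₄`-norm pair with `k₀` non-constant
gives a simple DEGENERATE CM abelian `4p`-fold with CM by `K`, `Gal(K/ℚ) ≅ C_p ⋊ C₈`** — every BAD type of the family is of this
form (all odd characters with non-trivial `ℤ/p`-part are Galois conjugate to `χ₀` or `χ̄₀`), so this is the format in which the SAT
certificates `p = 17, 19` (where no difference pair exists: `ord_p 2` even) are re-certified by `decide` on `ℤ/p`-data alone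
(part VI), and in which `p = 41, 43` are expected.

## References

* [Kubota1965] T. Kubota, *On the field extension by complex multiplication*, Trans. AMS 118 (1965), §2, §4 Lemma 2.
* [Shimura1998] G. Shimura, *Abelian Varieties with Complex Multiplication and Modular Functions*, §6.2 Thm. 3, §8.2 Prop. 26.
* [Gordon1999HodgeAVSurvey] B. B. Gordon, *A survey of the Hodge conjecture for abelian varieties*, Thm. 6.4, §9.3, Prop. 9.4.1.
-/

noncomputable section

open CategoryTheory CategoryTheory.Limits NumberField
open scoped BigOperators

namespace Summit.HodgeConjecture.CorCM.GaloisCyclicSemidirectEight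

open Literature.NumberTheory.ComplexMultiplication
open Literature.AlgebraicGeometry.Motives (AbelianVariety CMType)
open Literature.AlgebraicGeometry.HodgeTheory
open Literature.AlgebraicGeometry.ComplexMultiplication (IsCMTypeRealisation)
open Literature.AlgebraicGeometry.Pohlmann1968
open Literature.Barriers.HodgeConjecture (divisorClassesSpan)
open AddChar
open Multiplicative (ofAdd toAdd)

/-! ## The theorem -/

section Field

variable {p : ℕ} [Fact p.Prime]
variable {K : Type} [Field K] [NumberField K] [IsCMField K] [IsGalois ℚ K]

/-- **A `μ₄`-NORM PAIR IN `ℤ/p` MAKES `C_p ⋊ C₈` BAD.**  `e : Gal(K/ℚ) ≃* C_p ⋊ C₈` (`φ(1)` = inversion, `p` odd); sheets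
`k₀, k₁ : ℤ/p → ℤ/4` with `k₀` not constant and, with `Nⱼ(d,r) = #{v : kⱼ(v) + kⱼ(v−d) = r}`, the two balance identities
`N₀(d,0) + N₁(d,1) + N₀(0,2) + N₁(0,3) = N₀(0,0) + N₁(0,1) + N₀(d,2) + N₁(d,3)` and
`N₀(d,1) + N₁(d,2) + N₀(0,3) + N₁(0,0) = N₀(0,1) + N₁(0,2) + N₀(d,3) + N₁(d,0)` for every `d` (the coefficient of `ζ^d` in
`G₀(ζ)G₀(ζ⁻¹) − i G₁(ζ)G₁(ζ⁻¹)` does not depend on `d`).  Then `K` has a PRIMITIVE DEGENERATE CM type realised by a SIMPLE abelian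
variety of dimension `4p` with CM by `K` and a rational `(q,q)` class outside the divisor ring on some power. [cite: Kubota1965, §2
and §4 Lemma 2] [cite: Shimura1998, §6.2 Thm. 3 and §8.2 Prop. 26] [cite: Gordon1999HodgeAVSurvey, Thm. 6.4 and §9.3] -/
theorem exists_simple_degenerate_of_normPair (hp2 : p ≠ 2)
    (φ : Multiplicative (ZMod 8) →* MulAut (Multiplicative (ZMod p)))
    (hφ : ∀ v : Multiplicative (ZMod p), φ (ofAdd 1) v = v⁻¹)
    (e : (K ≃ₐ[ℚ] K) ≃* Multiplicative (ZMod p) ⋊[φ] Multiplicative (ZMod 8))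
    (k₀ k₁ : ZMod p → ZMod 4) (hk : ∃ v, k₀ v ≠ k₀ 0)
    (hR : ∀ d : ZMod p,
      (Finset.univ.filter fun v => k₀ v + k₀ (v - d) = 0).card +
            (Finset.univ.filter fun v => k₁ v + k₁ (v - d) = 1).card +
          (Finset.univ.filter fun v => k₀ v + k₀ v = 2).card + (Finset.univ.filter fun v => k₁ v + k₁ v = 3).card =
        (Finset.univ.filter fun v => k₀ v + k₀ v = 0).card + (Finset.univ.filter fun v => k₁ v + k₁ v = 1).card +
            (Finset.univ.filter fun v => k₀ v + k₀ (v - d) = 2).card +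
          (Finset.univ.filter fun v => k₁ v + k₁ (v - d) = 3).card)
    (hI : ∀ d : ZMod p,
      (Finset.univ.filter fun v => k₀ v + k₀ (v - d) = 1).card +
            (Finset.univ.filter fun v => k₁ v + k₁ (v - d) = 2).card +
          (Finset.univ.filter fun v => k₀ v + k₀ v = 3).card + (Finset.univ.filter fun v => k₁ v + k₁ v = 0).card =
        (Finset.univ.filter fun v => k₀ v + k₀ v = 1).card + (Finset.univ.filter fun v => k₁ v + k₁ v = 2).card +
            (Finset.univ.filter fun v => k₀ v + k₀ (v - d) = 3).card +
          (Finset.univ.filter fun v => k₁ v + k₁ (v - d) = 0).card) :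
    ∃ (Φ : CMType K) (φ₀ : K →+* ℂ) (A : AbelianVariety ℂ) (ι : 𝓞 K →+* End A)
      (θ : K →+* Module.End ℂ (complexBetti A.X 1)),
      IsPrimitive (ℂ ≃+* ℂ) Φ.1 φ₀ ∧ ¬ IsNondegenerate Φ ∧ IsCMTypeRealisation Φ A ι θ ∧ A.IsSimple ∧ A.dim = 4 * p ∧
      ∃ n q : ℕ, ∃ x : complexBetti (⨁ fun _ : Fin n => A).X (2 * q), IsRationalClass x ∧
        IsOfHodgeType (⨁ fun _ : Fin n => A).dim (⨁ fun _ : Fin n => A).X (2 * q) q q x ∧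
        x ∉ divisorClassesSpan (⨁ fun _ : Fin n => A).X (⨁ fun _ : Fin n => A).dim q := by
  classical
  have hp : p.Prime := Fact.out
  haveI : NeZero p := ⟨hp.ne_zero⟩
  haveI : Fact (1 < p) := ⟨hp.one_lt⟩
  haveI : Fintype (Multiplicative (ZMod p) ⋊[φ] Multiplicative (ZMod 8)) :=
    Fintype.ofEquiv _ SemidirectProduct.equivProd.symm
  obtain ⟨v₁, hv₁⟩ := hk
  -- the CM set `T(k₀, k₁)`
  set T : Finset (Multiplicative (ZMod p) ⋊[φ] Multiplicative (ZMod 8)) := Finset.univ.filter fun g =>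
    (toAdd g.right = ((2 * (k₀ (toAdd g.left)).val : ℕ) : ZMod 8) ∨
          toAdd g.right = ((2 * (k₀ (toAdd g.left)).val : ℕ) : ZMod 8) + 2 ∨
        toAdd g.right = ((2 * (k₁ (toAdd g.left)).val : ℕ) : ZMod 8) + 1 ∨
          toAdd g.right = ((2 * (k₁ (toAdd g.left)).val : ℕ) : ZMod 8) + 3) with hT_def
  have hT' : ∀ (x : Multiplicative (ZMod p)) (y : Multiplicative (ZMod 8)),
      (⟨x, y⟩ : Multiplicative (ZMod p) ⋊[φ] Multiplicative (ZMod 8)) ∈ T ↔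
      (toAdd y = ((2 * (k₀ (toAdd x)).val : ℕ) : ZMod 8) ∨ toAdd y = ((2 * (k₀ (toAdd x)).val : ℕ) : ZMod 8) + 2 ∨
          toAdd y = ((2 * (k₁ (toAdd x)).val : ℕ) : ZMod 8) + 1 ∨ toAdd y = ((2 * (k₁ (toAdd x)).val : ℕ) : ZMod 8) + 3) :=
    fun x y => by
    rw [hT_def, Finset.mem_filter]
    simp only [Finset.mem_univ, true_and]
  have hT : ∀ g, g ∈ T ↔ (toAdd g.right = ((2 * (k₀ (toAdd g.left)).val : ℕ) : ZMod 8) ∨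
        toAdd g.right = ((2 * (k₀ (toAdd g.left)).val : ℕ) : ZMod 8) + 2 ∨
      toAdd g.right = ((2 * (k₁ (toAdd g.left)).val : ℕ) : ZMod 8) + 1 ∨
        toAdd g.right = ((2 * (k₁ (toAdd g.left)).val : ℕ) : ZMod 8) + 3) := fun g => hT' g.left g.right
  -- the action: even elements act trivially, odd ones invert
  have hφe : ∀ (n : ℕ) (x : Multiplicative (ZMod p)), φ (ofAdd (2 : ZMod 8) ^ n) x = x := phi_two_pow φ hφ
  have hφo : ∀ (n : ℕ) (x : Multiplicative (ZMod p)), φ (ofAdd (2 : ZMod 8) ^ n * ofAdd 1) x = x⁻¹ := fun n x => by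
    rw [map_mul, MulAut.mul_apply, hφ, hφe]
  have hdecomp : ∀ m : Multiplicative (ZMod 8), m = ofAdd (2 : ZMod 8) ^ ((toAdd m).val / 2) *
      ofAdd (1 : ZMod 8) ^ ((toAdd m).val % 2) := fun m => by
    set n : ℕ := (toAdd m).val with hn_def
    rw [← ofAdd_nsmul, ← ofAdd_nsmul, ← ofAdd_add, nsmul_eq_mul, nsmul_eq_mul]
    conv_lhs => rw [← ofAdd_toAdd m, ← ZMod.natCast_zmod_val (toAdd m)]
    rw [← hn_def]
    conv_lhs => rw [← Nat.div_add_mod n 2]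
    congr 1
    push_cast
    ring
  -- (a) CM set for `c₀ = inr 4`
  have h4 : ofAdd (4 : ZMod 8) = ofAdd (2 : ZMod 8) ^ 2 := by decide
  have hScm : ∀ g, g ∈ T ↔ SemidirectProduct.inr (ofAdd (4 : ZMod 8)) * g ∉ T := fun g => by
    rw [hT, hT, SemidirectProduct.mul_right, SemidirectProduct.right_inr, toAdd_mul, toAdd_ofAdd, SemidirectProduct.mul_left,
      SemidirectProduct.left_inr, SemidirectProduct.right_inr, one_mul, h4, hφe, normPred_four_add, not_not]
  -- (b) trivial left stabiliser (`k₀` non-constant suffices)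
  have h2t : ∀ t : ZMod 4, toAdd (ofAdd (2 : ZMod 8) ^ t.val) = ((2 * t.val : ℕ) : ZMod 8) := fun t => by
    rw [← ofAdd_nsmul, toAdd_ofAdd, nsmul_eq_mul, Nat.cast_mul, Nat.cast_ofNat, mul_comm]
  have hmem₀ : ∀ v : ZMod p, (⟨ofAdd v, ofAdd ((2 * (k₀ v).val : ℕ) : ZMod 8)⟩ :
      Multiplicative (ZMod p) ⋊[φ] Multiplicative (ZMod 8)) ∈ T := fun v => by
    rw [hT', toAdd_ofAdd, toAdd_ofAdd]; exact Or.inl rfl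
  have hmem₀' : ∀ v : ZMod p, (⟨ofAdd v, ofAdd (((2 * (k₀ v).val : ℕ) : ZMod 8) + 2)⟩ :
      Multiplicative (ZMod p) ⋊[φ] Multiplicative (ZMod 8)) ∈ T := fun v => by
    rw [hT', toAdd_ofAdd, toAdd_ofAdd]; exact Or.inr (Or.inl rfl)
  have hmem₁ : ∀ v : ZMod p, (⟨ofAdd v, ofAdd (((2 * (k₁ v).val : ℕ) : ZMod 8) + 1)⟩ :
      Multiplicative (ZMod p) ⋊[φ] Multiplicative (ZMod 8)) ∈ T := fun v => by
    rw [hT', toAdd_ofAdd, toAdd_ofAdd]; exact Or.inr (Or.inr (Or.inl rfl))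
  have hmem₁' : ∀ v : ZMod p, (⟨ofAdd v, ofAdd (((2 * (k₁ v).val : ℕ) : ZMod 8) + 3)⟩ :
      Multiplicative (ZMod p) ⋊[φ] Multiplicative (ZMod 8)) ∈ T := fun v => by
    rw [hT', toAdd_ofAdd, toAdd_ofAdd]; exact Or.inr (Or.inr (Or.inr rfl))
  have hprim : ∀ g : Multiplicative (ZMod p) ⋊[φ] Multiplicative (ZMod 8), g ≠ 1 → ∃ w, ¬ (w ∈ T ↔ g * w ∈ T) := by
    rintro ⟨v₀, s₀⟩ hg
    by_contra hall
    push Not at hall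
    have hm := hdecomp s₀
    rcases Nat.mod_two_eq_zero_or_one (toAdd s₀).val with h0 | h1
    · -- even `s₀`: `φ s₀ = id`, the even sheet is shifted: `s₀ + 2k₀(v) = 2k₀(v₀ + v)`
      have hφs : ∀ x, φ s₀ x = x := fun x => by rw [hm, h0, pow_zero, mul_one, hφe]
      have hmul : ∀ (x : Multiplicative (ZMod p)) (y : Multiplicative (ZMod 8)),
          (⟨v₀, s₀⟩ * ⟨x, y⟩ : Multiplicative (ZMod p) ⋊[φ] Multiplicative (ZMod 8)) = ⟨v₀ * x, s₀ * y⟩ := fun x y => by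
        refine SemidirectProduct.ext ?_ ?_
        · rw [SemidirectProduct.mul_left]
          show v₀ * φ s₀ x = v₀ * x
          rw [hφs]
        · rw [SemidirectProduct.mul_right]
      have hshift : ∀ v : ZMod p, toAdd s₀ + ((2 * (k₀ v).val : ℕ) : ZMod 8) = ((2 * (k₀ (toAdd v₀ + v)).val : ℕ) : ZMod 8) :=
        fun v => by
        have h1 := (hall _).1 (hmem₀ v)
        have h2 := (hall _).1 (hmem₀' v)
        rw [hmul, hT', toAdd_mul, toAdd_ofAdd, toAdd_mul, toAdd_ofAdd] at h1 h2
        rw [← add_assoc] at h2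
        exact normPred_even_shift _ _ _ _ h0 h1 h2
      -- summing over `v`: `p • s₀ = 0`, so `s₀ = 0`
      have hsum : ∑ v : ZMod p, (toAdd s₀ + ((2 * (k₀ v).val : ℕ) : ZMod 8)) = ∑ v : ZMod p, ((2 * (k₀ v).val : ℕ) : ZMod 8) := by
        rw [Finset.sum_congr rfl fun v _ => hshift v]
        exact Fintype.sum_equiv (Equiv.addLeft (toAdd v₀)) _ _ fun v => rfl
      rw [Finset.sum_add_distrib, Finset.sum_const, Finset.card_univ, ZMod.card, add_eq_right] at hsum
      have hs0 : toAdd s₀ = 0 := by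
        have hunit : IsUnit (p : ZMod 8) := by
          rw [ZMod.isUnit_iff_coprime]
          exact (Nat.coprime_primes hp (by norm_num)).2 hp2 |>.pow_right 3
        rw [nsmul_eq_mul] at hsum
        exact (hunit.mul_right_eq_zero).1 hsum
      -- hence `k₀` is `v₀`-periodic
      have hper : ∀ v, k₀ (toAdd v₀ + v) = k₀ v := fun v => by
        have h := hshift v
        rw [hs0, zero_add] at h
        exact ((normPred_sheets (k₀ (toAdd v₀ + v)) (k₀ v) (k₁ v)).2.2.1 h.symm)
      by_cases hv : toAdd v₀ = 0
      · apply hg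
        have h1 : v₀ = 1 := by rw [← ofAdd_toAdd v₀, hv]; rfl
        have h2 : s₀ = 1 := by rw [← ofAdd_toAdd s₀, hs0]; rfl
        rw [h1, h2]; rfl
      · exact hv₁ (apply_eq_apply_of_forall_add k₀ hv hper v₁ 0)
    · -- odd `s₀`: `φ s₀ = inv`; the four memberships over the fibres of `v` and `v₀ − v` clash
      have hφs : ∀ x, φ s₀ x = x⁻¹ := fun x => by rw [hm, h1, pow_one, hφo]
      have hmul : ∀ (x : Multiplicative (ZMod p)) (y : Multiplicative (ZMod 8)),
          (⟨v₀, s₀⟩ * ⟨x, y⟩ : Multiplicative (ZMod p) ⋊[φ] Multiplicative (ZMod 8)) = ⟨v₀ * x⁻¹, s₀ * y⟩ := fun x y => by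
        refine SemidirectProduct.ext ?_ ?_
        · rw [SemidirectProduct.mul_left]
          show v₀ * φ s₀ x = v₀ * x⁻¹
          rw [hφs]
        · rw [SemidirectProduct.mul_right]
      set v : ZMod p := 0 with hv_def
      set v' : ZMod p := toAdd v₀ - v with hv'_def
      have e1 : toAdd (v₀ * (ofAdd v)⁻¹) = v' := by rw [toAdd_mul, toAdd_inv, toAdd_ofAdd, hv'_def, sub_eq_add_neg]
      have e2 : toAdd (v₀ * (ofAdd v')⁻¹) = v := by
        rw [toAdd_mul, toAdd_inv, toAdd_ofAdd, hv'_def]; ring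
      have ha := (hall _).1 (hmem₀ v)
      have hb := (hall _).1 (hmem₀' v)
      have hc := (hall _).1 (hmem₁ v')
      have hd := (hall _).1 (hmem₁' v')
      rw [hmul, hT', e1, toAdd_mul, toAdd_ofAdd] at ha hb
      rw [hmul, hT', e2, toAdd_mul, toAdd_ofAdd] at hc hd
      rw [← add_assoc] at hb hc hd
      exact normPred_odd _ _ _ _ _ h1 ha hb hc hd
  -- (c) the sheets of `T` on `ℤ/4 × ℤ/p`: graphs of `k₀, k₀ + 1` and `k₁, k₁ + 1`
  set gr : (ZMod p → ZMod 4) → Finset (Multiplicative (ZMod 4) × Multiplicative (ZMod p)) := fun k =>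
    Finset.univ.map ⟨fun v => (ofAdd (k v), ofAdd v), fun v w h => by simpa using congrArg Prod.snd h⟩ with hgr_def
  have hgr : ∀ (k : ZMod p → ZMod 4) (t : Multiplicative (ZMod 4)) (x : Multiplicative (ZMod p)),
      (t, x) ∈ gr k ↔ toAdd t = k (toAdd x) := fun k t x => by
    simp only [hgr_def, Finset.mem_map, Finset.mem_univ, true_and, Function.Embedding.coeFn_mk, Prod.mk.injEq]
    constructor
    · rintro ⟨w, h1, h2⟩
      rw [← h1, ← h2, toAdd_ofAdd, toAdd_ofAdd]
    · intro h
      exact ⟨toAdd x, by rw [← h, ofAdd_toAdd], ofAdd_toAdd x⟩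
  have hgr_sum : ∀ (k : ZMod p → ZMod 4) (f : Multiplicative (ZMod 4) × Multiplicative (ZMod p) → ℂ),
      ∑ w ∈ gr k, f w = ∑ v : ZMod p, f (ofAdd (k v), ofAdd v) := fun k f => by
    rw [hgr_def, Finset.sum_map]; rfl
  have hgr_disj : ∀ k : ZMod p → ZMod 4, Disjoint (gr k) (gr fun v => k v + 1) := fun k => by
    rw [Finset.disjoint_left]
    rintro ⟨t, x⟩ h1 h2
    rw [hgr] at h1 h2
    exact (normPred_sheets (k (toAdd x)) (k (toAdd x)) (k (toAdd x))).2.2.2 (h1.symm.trans h2)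
  set S₁ : Finset (Multiplicative (ZMod 4) × Multiplicative (ZMod p)) := gr k₀ ∪ gr (fun v => k₀ v + 1) with hS₁_def
  set S₂ : Finset (Multiplicative (ZMod 4) × Multiplicative (ZMod p)) := gr k₁ ∪ gr (fun v => k₁ v + 1) with hS₂_def
  have hS₁ : ∀ (t : Multiplicative (ZMod 4)) (x : Multiplicative (ZMod p)), (t, x) ∈ S₁ ↔
      (⟨x, ofAdd (2 : ZMod 8) ^ (toAdd t).val⟩ : Multiplicative (ZMod p) ⋊[φ] Multiplicative (ZMod 8)) ∈ T := fun t x => by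
    rw [hT', h2t, (normPred_sheets (toAdd t) _ _).1, hS₁_def, Finset.mem_union, hgr, hgr]
  have hy : ∀ (t : Multiplicative (ZMod 4)) (x : Multiplicative (ZMod p)),
      (⟨x, ofAdd (2 : ZMod 8) ^ (toAdd t).val⟩ : Multiplicative (ZMod p) ⋊[φ] Multiplicative (ZMod 8)) *
        SemidirectProduct.inr (ofAdd (1 : ZMod 8)) = ⟨x, ofAdd (2 : ZMod 8) ^ (toAdd t).val * ofAdd 1⟩ := fun t x => by
    refine SemidirectProduct.ext ?_ ?_
    · rw [SemidirectProduct.mul_left, SemidirectProduct.left_inr, map_one, mul_one]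
    · rw [SemidirectProduct.mul_right, SemidirectProduct.right_inr]
  have hS₂ : ∀ (t : Multiplicative (ZMod 4)) (x : Multiplicative (ZMod p)), (t, x) ∈ S₂ ↔
      (⟨x, ofAdd (2 : ZMod 8) ^ (toAdd t).val⟩ : Multiplicative (ZMod p) ⋊[φ] Multiplicative (ZMod 8)) *
        SemidirectProduct.inr (ofAdd (1 : ZMod 8)) ∈ T := fun t x => by
    rw [hy, hT', toAdd_mul, h2t, toAdd_ofAdd, (normPred_sheets (toAdd t) _ _).2.1, hS₂_def, Finset.mem_union, hgr, hgr]
  -- (d) the odd character `χ₀ = (iᵗ ζᵛ)` and its sheet sums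
  have hζ : IsPrimitiveRoot (Complex.exp (2 * Real.pi * Complex.I / p)) p := Complex.isPrimitiveRoot_exp p hp.ne_zero
  set ψp : AddChar (ZMod p) ℂ := AddChar.zmodChar p hζ.pow_eq_one with hψp_def
  have hψp1 : ψp ≠ 1 := by
    intro h
    have h1 : ψp 1 = 1 := by rw [h, AddChar.one_apply]
    rw [hψp_def, AddChar.zmodChar_apply, ZMod.val_one, pow_one] at h1
    exact hζ.ne_one hp.one_lt h1
  have hsumψ : ∑ a : ZMod p, ψp a = 0 := AddChar.sum_eq_zero_of_ne_one hψp1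
  set ψ4 : AddChar (ZMod 4) ℂ := AddChar.zmodChar 4 Complex.I_pow_four with hψ4_def
  have hψ4v : ψ4 0 = 1 ∧ ψ4 1 = Complex.I ∧ ψ4 2 = -1 ∧ ψ4 3 = -Complex.I := by
    refine ⟨by rw [map_zero_eq_one], ?_, ?_, ?_⟩ <;> rw [hψ4_def, AddChar.zmodChar_apply]
    · rw [show (1 : ZMod 4).val = 1 from rfl, pow_one]
    · rw [show (2 : ZMod 4).val = 2 from rfl, Complex.I_sq]
    · rw [show (3 : ZMod 4).val = 3 from rfl, pow_succ, Complex.I_sq]; ring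
  let χ₀ : AddChar (Additive (Multiplicative (ZMod 4) × Multiplicative (ZMod p))) ℂ :=
    { toFun := fun w => ψ4 (toAdd (Additive.toMul w).1) * ψp (toAdd (Additive.toMul w).2)
      map_zero_eq_one' := by simp
      map_add_eq_mul' := fun w w' => by
        simp only [toMul_add, Prod.fst_mul, Prod.snd_mul, toAdd_mul, map_add_eq_mul]; ring }
  have hχ₀ : ∀ (t : Multiplicative (ZMod 4)) (x : Multiplicative (ZMod p)),
      χ₀ (Additive.ofMul (t, x)) = ψ4 (toAdd t) * ψp (toAdd x) := fun t x => rfl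
  have hχc : χ₀ (Additive.ofMul (ofAdd (2 : ZMod 4), (1 : Multiplicative (ZMod p)))) = -1 := by
    rw [hχ₀, toAdd_ofAdd, toAdd_one, hψ4v.2.2.1, map_zero_eq_one, mul_one]
  have hχq : χ₀ (Additive.ofMul (ofAdd (1 : ZMod 4), (1 : Multiplicative (ZMod p)))) = Complex.I := by
    rw [hχ₀, toAdd_ofAdd, toAdd_one, hψ4v.2.1, map_zero_eq_one, mul_one]
  -- sheet sums `Ŝⱼ = (1 + i) Gⱼ`, for any second factor `η`
  have hsheet : ∀ (k : ZMod p → ZMod 4) (η : ZMod p → ℂ),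
      ∑ w ∈ gr k ∪ gr (fun v => k v + 1), ψ4 (toAdd w.1) * η (toAdd w.2) =
      (1 + Complex.I) * ∑ v : ZMod p, ψ4 (k v) * η v := fun k η => by
    rw [Finset.sum_union (hgr_disj k), hgr_sum, hgr_sum, Finset.mul_sum, ← Finset.sum_add_distrib]
    refine Finset.sum_congr rfl fun v _ => ?_
    simp only [toAdd_ofAdd]
    rw [map_add_eq_mul, hψ4v.2.1]; ring
  have eA : ∑ s ∈ S₁, χ₀ (Additive.ofMul s) = ∑ w ∈ S₁, ψ4 (toAdd w.1) * ψp (toAdd w.2) :=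
    Finset.sum_congr rfl fun w _ => hχ₀ w.1 w.2
  have eAθ : ∑ s ∈ S₁, χ₀ (Additive.ofMul (s.1, s.2⁻¹)) = ∑ w ∈ S₁, ψ4 (toAdd w.1) * ψp (-toAdd w.2) :=
    Finset.sum_congr rfl fun w _ => by rw [hχ₀, toAdd_inv]
  have eB : ∑ t ∈ S₂, χ₀ (Additive.ofMul t) = ∑ w ∈ S₂, ψ4 (toAdd w.1) * ψp (toAdd w.2) :=
    Finset.sum_congr rfl fun w _ => hχ₀ w.1 w.2
  have eBθ : ∑ t ∈ S₂, χ₀ (Additive.ofMul (t.1, t.2⁻¹)) = ∑ w ∈ S₂, ψ4 (toAdd w.1) * ψp (-toAdd w.2) :=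
    Finset.sum_congr rfl fun w _ => by rw [hχ₀, toAdd_inv]
  -- (e) the coefficient of `ζ^d`: `cⱼ(d) = Σ_v ψ4 (kⱼ v + kⱼ (v - d)) = Σ_r Nⱼ(d,r) i^r`
  have hC : ∀ k : ZMod p → ZMod 4, (∑ v : ZMod p, ψ4 (k v) * ψp v) * (∑ v : ZMod p, ψ4 (k v) * ψp (-v)) =
      ∑ d : ZMod p, (∑ v : ZMod p, ψ4 (k v + k (v - d))) * ψp d := fun k => by
    rw [Finset.sum_mul_sum]
    have e1 : ∀ v : ZMod p, ∑ w : ZMod p, ψ4 (k v) * ψp v * (ψ4 (k w) * ψp (-w)) =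
        ∑ d : ZMod p, ψ4 (k v + k (v - d)) * ψp d := fun v => by
      refine Fintype.sum_equiv (Equiv.subLeft v) _ _ fun w => ?_
      simp only [Equiv.subLeft_apply, sub_sub_cancel, map_add_eq_mul]
      rw [show ψp (v - w) = ψp v * ψp (-w) by rw [sub_eq_add_neg, map_add_eq_mul]]
      ring
    simp_rw [e1]
    rw [Finset.sum_comm]
    refine Finset.sum_congr rfl fun d _ => ?_
    rw [Finset.sum_mul]
  have hN : ∀ (k : ZMod p → ZMod 4) (d : ZMod p), ∑ v : ZMod p, ψ4 (k v + k (v - d)) =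
      ∑ r : ZMod 4, ((Finset.univ.filter fun v => k v + k (v - d) = r).card : ℂ) * ψ4 r := fun k d => by
    rw [← Finset.sum_fiberwise' Finset.univ (fun v => k v + k (v - d)) (fun r => ψ4 r)]
    refine Finset.sum_congr rfl fun r _ => ?_
    rw [Finset.sum_const, nsmul_eq_mul]
  have h4sum : ∀ f : ZMod 4 → ℂ, ∑ r : ZMod 4, f r = f 0 + f 1 + f 2 + f 3 := fun f => by
    rw [show (Finset.univ : Finset (ZMod 4)) = {0, 1, 2, 3} from rfl]
    rw [Finset.sum_insert (by decide), Finset.sum_insert (by decide), Finset.sum_insert (by decide), Finset.sum_singleton]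
    ring
  -- the coefficient `c₀(d) − i c₁(d)` is constant in `d`
  have hconst : ∀ d : ZMod p, (∑ v : ZMod p, ψ4 (k₀ v + k₀ (v - d))) - Complex.I * (∑ v : ZMod p, ψ4 (k₁ v + k₁ (v - d))) =
      (∑ v : ZMod p, ψ4 (k₀ v + k₀ (v - 0))) - Complex.I * (∑ v : ZMod p, ψ4 (k₁ v + k₁ (v - 0))) := fun d => by
    have hRd : _ := hR d
    have hId : _ := hI d
    rw [hN, hN, hN, hN, h4sum, h4sum, h4sum, h4sum, hψ4v.1, hψ4v.2.1, hψ4v.2.2.1, hψ4v.2.2.2]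
    simp only [sub_zero]
    have hR' : (((Finset.univ.filter fun v => k₀ v + k₀ (v - d) = 0).card : ℕ) : ℂ) +
        ((Finset.univ.filter fun v => k₁ v + k₁ (v - d) = 1).card : ℂ) +
        ((Finset.univ.filter fun v => k₀ v + k₀ v = 2).card : ℂ) + ((Finset.univ.filter fun v => k₁ v + k₁ v = 3).card : ℂ) =
        ((Finset.univ.filter fun v => k₀ v + k₀ v = 0).card : ℂ) + ((Finset.univ.filter fun v => k₁ v + k₁ v = 1).card : ℂ) +
        ((Finset.univ.filter fun v => k₀ v + k₀ (v - d) = 2).card : ℂ) +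
        ((Finset.univ.filter fun v => k₁ v + k₁ (v - d) = 3).card : ℂ) := by exact_mod_cast hRd
    have hI' : (((Finset.univ.filter fun v => k₀ v + k₀ (v - d) = 1).card : ℕ) : ℂ) +
        ((Finset.univ.filter fun v => k₁ v + k₁ (v - d) = 2).card : ℂ) +
        ((Finset.univ.filter fun v => k₀ v + k₀ v = 3).card : ℂ) + ((Finset.univ.filter fun v => k₁ v + k₁ v = 0).card : ℂ) =
        ((Finset.univ.filter fun v => k₀ v + k₀ v = 1).card : ℂ) + ((Finset.univ.filter fun v => k₁ v + k₁ v = 2).card : ℂ) +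
        ((Finset.univ.filter fun v => k₀ v + k₀ (v - d) = 3).card : ℂ) +
        ((Finset.univ.filter fun v => k₁ v + k₁ (v - d) = 0).card : ℂ) := by exact_mod_cast hId
    linear_combination hR' + Complex.I * hI' +
      ((((Finset.univ.filter fun v => k₁ v + k₁ (v - d) = 3).card : ℕ) : ℂ) -
        ((Finset.univ.filter fun v => k₁ v + k₁ (v - d) = 1).card : ℂ) +
        ((Finset.univ.filter fun v => k₁ v + k₁ v = 1).card : ℂ) - ((Finset.univ.filter fun v => k₁ v + k₁ v = 3).card : ℂ)) *
        Complex.I_sq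
  have hAB : (∑ v : ZMod p, ψ4 (k₀ v) * ψp v) * (∑ v : ZMod p, ψ4 (k₀ v) * ψp (-v)) -
      Complex.I * ((∑ v : ZMod p, ψ4 (k₁ v) * ψp v) * (∑ v : ZMod p, ψ4 (k₁ v) * ψp (-v))) = 0 := by
    rw [hC, hC, Finset.mul_sum, ← Finset.sum_sub_distrib]
    have e2 : ∀ d : ZMod p, (∑ v : ZMod p, ψ4 (k₀ v + k₀ (v - d))) * ψp d -
        Complex.I * ((∑ v : ZMod p, ψ4 (k₁ v + k₁ (v - d))) * ψp d) =
        ((∑ v : ZMod p, ψ4 (k₀ v + k₀ (v - 0))) - Complex.I * (∑ v : ZMod p, ψ4 (k₁ v + k₁ (v - 0)))) * ψp d := fun d => by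
      rw [← hconst d]; ring
    simp_rw [e2]
    rw [← Finset.mul_sum, hsumψ, mul_zero]
  -- (f) the singular block
  have hΔ : (∑ s ∈ S₁, χ₀ (Additive.ofMul s)) * (∑ s ∈ S₁, χ₀ (Additive.ofMul (s.1, s.2⁻¹))) -
      χ₀ (Additive.ofMul (ofAdd (1 : ZMod 4), (1 : Multiplicative (ZMod p)))) *
        ((∑ t ∈ S₂, χ₀ (Additive.ofMul t)) * (∑ t ∈ S₂, χ₀ (Additive.ofMul (t.1, t.2⁻¹)))) = 0 := by
    rw [eA, eAθ, eB, eBθ, hχq, hS₁_def, hS₂_def, hsheet k₀ (fun v => ψp v), hsheet k₀ (fun v => ψp (-v)),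
      hsheet k₁ (fun v => ψp v), hsheet k₁ (fun v => ψp (-v))]
    linear_combination (1 + Complex.I) ^ 2 * hAB
  exact exists_simple_degenerate_of_singular_block hp2 φ hφ e T hScm hprim S₁ S₂ (fun w => hS₁ w.1 w.2)
    (fun w => hS₂ w.1 w.2) χ₀ hχc hΔ

end Field

end Summit.HodgeConjecture.CorCM.GaloisCyclicSemidirectEight

end
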